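import Mathlib.Analysis.SpecialFunctions.Trigonometric.Series
import Mathlib.Analysis.SpecialFunctions.Trigonometric.DerivHyp
import Mathlib.Analysis.SpecialFunctions.SmoothTransition
import Mathlib.Analysis.SpecialFunctions.Pow.Real
import Mathlib.MeasureTheory.Integral.Bochner.Basic
import Mathlib.MeasureTheory.Integral.Bochner.Set
import Mathlib.MeasureTheory.Function.ContinuousMapDense
import Mathlib.MeasureTheory.Measure.Lebesgue.Basic
import Summits.RiemannHypothesis.RiemannHypothesis.Theorems.WeilCombCombShapePositivityBumpQuadrature
import HarnessLib

/-!
# Cosh-moments of the fixed bump: `Φ(y) = ∫ φ₀(v) cosh(yv) dv ≤ I₀ + (cosh y − 1) m₂` and the edge decay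
# `Φ(y) ≤ 2 e^{y − √(2y)}` (STUB-PLAN `stub_windowCore`, helper B1, the one-variable estimates)

Crux `WeilComb.CombShapePositivity` (item stmt-RiemannHypothesis-11229), line `Sketch`, STUB-PLAN
`stub_windowCore` Phase B, helper B1. By the landed cosh-moment series (…ArchCoshSeries,
`stub_archEntryCoshSeries`: `−Re W_∞(τ_x ψ_ε) = Σ_k e^{−(2k+½)x} Φ((2k+½)ε)²`) every window-uniform bound of the
off-diagonal archimedean entries is a statement about the cosh-moments `Φ(y) = ∫ φ₀(v) cosh(yv) dv` of the
fixed bump `φ₀(v) = expNegInvGlue (1 − v²)` (`Φ(0) = I₀`). This file proves the two estimates that a lower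
entry bound (B1, lower half) consumes:

* `cosh_mul_le` — `cosh(yv) ≤ 1 + v²(cosh y − 1)` for `|v| ≤ 1` (termwise in the cosh series: `v^{2n} ≤ v²`);
* `stub_coshMomentSmall` (registered) — **`Φ(y) ≤ I₀ + (cosh y − 1)·m₂`**, `m₂ = ∫ φ₀(v) v² dv` (sharp to second order:
  `Φ(y) = I₀ + m₂ y²/2 + O(y⁴)`);
* `shapeBump_le_exp_edge` — `φ₀(v) ≤ e^{−1/(2(1−|v|))}` (`1 − v² ≤ 2(1 − |v|)`);
* `stub_coshMomentEdge` (registered) — **`Φ(y) ≤ 2 e^{y − √(2y)}` for `y ≥ 0`** (pointwise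
  `φ₀(v) cosh(yv) ≤ e^{y − (1/(2δ) + yδ)} ≤ e^{y − √(2y)}`, `δ = 1 − |v|`, AM–GM), the super-exponential gain over the
  crude `Φ(y) ≤ e^{y} I₀` that tames the extreme top entries (`x − 2ε ≈ 1/(2M²)`).
-/

noncomputable section

-- the sub-problem path RiemannHypothesis/RiemannHypothesis duplicates a namespace (D-0017)
set_option linter.dupNamespace false

open MeasureTheory Set

namespace Summit.RiemannHypothesis.RiemannHypothesis.Theorems.WeilCombCoshMoments

open Summit.RiemannHypothesis.RiemannHypothesis.Theorems.WeilCombBohrFejer (shapeBump_eq_zero)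

/-! ### The bump: continuity, support, integrability -/

/-- `φ₀` is continuous. [folklore] -/
theorem continuous_shapeBump : Continuous fun v : ℝ ↦ expNegInvGlue (1 - v ^ 2) :=
  (expNegInvGlue.contDiff (n := 0)).continuous.comp (by fun_prop)

/-- `supp φ₀ ⊆ [−1, 1]`. [folklore] -/
theorem support_shapeBump_subset : Function.support (fun v : ℝ ↦ expNegInvGlue (1 - v ^ 2)) ⊆ Icc (-1) 1 := by
  intro v hv
  rw [Function.mem_support] at hv
  by_contra h
  apply hv
  apply shapeBump_eq_zero
  rw [mem_Icc, not_and_or, not_le, not_le] at h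
  rcases h with h | h <;> nlinarith

/-- `φ₀` has compact support. [folklore] -/
theorem hasCompactSupport_shapeBump : HasCompactSupport fun v : ℝ ↦ expNegInvGlue (1 - v ^ 2) :=
  HasCompactSupport.of_support_subset_isCompact isCompact_Icc support_shapeBump_subset

/-- `φ₀ · h` is integrable for continuous `h`. [folklore] -/
theorem integrable_shapeBump_mul {h : ℝ → ℝ} (hh : Continuous h) :
    Integrable fun v : ℝ ↦ expNegInvGlue (1 - v ^ 2) * h v :=
  (continuous_shapeBump.mul hh).integrable_of_hasCompactSupport hasCompactSupport_shapeBump.mul_right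

/-! ### Small `y`: the second-moment bound -/

/-- **`cosh(yv) ≤ 1 + v²(cosh y − 1)` for `|v| ≤ 1`** (termwise in `cosh t = Σ t^{2n}/(2n)!`:
`(yv)^{2n} = y^{2n}(v²)ⁿ ≤ y^{2n} v²` for `n ≥ 1`). [folklore] -/
theorem cosh_mul_le (y : ℝ) {v : ℝ} (hv : |v| ≤ 1) :
    Real.cosh (y * v) ≤ 1 + v ^ 2 * (Real.cosh y - 1) := by
  have hv2 : v ^ 2 ≤ 1 := by
    rw [← sq_abs]; nlinarith [abs_nonneg v]
  have hv0 : 0 ≤ v ^ 2 := sq_nonneg v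
  have ha := Real.hasSum_cosh (y * v)
  have hb0 := (Real.hasSum_cosh y).mul_left (v ^ 2)
  -- `b n = v² y^{2n}/(2n)! + [n = 0](1 − v²)` sums to `v² cosh y + (1 − v²)`
  have hδ : HasSum (fun n : ℕ ↦ if n = 0 then (1 - v ^ 2 : ℝ) else 0) (1 - v ^ 2) := hasSum_ite_eq 0 _
  have hb := hb0.add hδ
  have hle : ∀ n : ℕ, (y * v) ^ (2 * n) / ((2 * n).factorial : ℝ) ≤
      v ^ 2 * (y ^ (2 * n) / ((2 * n).factorial : ℝ)) + (if n = 0 then (1 - v ^ 2 : ℝ) else 0) := by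
    intro n
    rcases Nat.eq_zero_or_pos n with rfl | hn
    · simp
    · rw [if_neg (by omega), add_zero, mul_pow, pow_mul v 2 n]
      have hfac : (0 : ℝ) < ((2 * n).factorial : ℝ) := by positivity
      have hy : 0 ≤ y ^ (2 * n) := by rw [pow_mul]; positivity
      have hvn : (v ^ 2) ^ n ≤ v ^ 2 := pow_le_of_le_one hv0 hv2 (by omega)
      rw [mul_div_assoc]
      have e : y ^ (2 * n) * ((v ^ 2) ^ n / ((2 * n).factorial : ℝ)) =
          (v ^ 2) ^ n * (y ^ (2 * n) / ((2 * n).factorial : ℝ)) := by ring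
      rw [e]
      exact mul_le_mul_of_nonneg_right hvn (by positivity)
  have := hasSum_le hle ha hb
  linarith

/-- **Stub `stub_coshMomentSmall` (B1 one-variable estimate, small `y`; registered on crux
stmt-RiemannHypothesis-11229).** `∫ φ₀(v) cosh(yv) dv ≤ ∫ φ₀ + (cosh y − 1) ∫ φ₀(v) v² dv` for every real `y`.
[folklore] -/
theorem stub_coshMomentSmall : ∀ y : ℝ,
    ∫ v : ℝ, expNegInvGlue (1 - v ^ 2) * Real.cosh (y * v) ≤
      (∫ v : ℝ, expNegInvGlue (1 - v ^ 2)) +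
        (Real.cosh y - 1) * ∫ v : ℝ, expNegInvGlue (1 - v ^ 2) * v ^ 2 := by
  intro y
  have h1 : Integrable fun v : ℝ ↦ expNegInvGlue (1 - v ^ 2) * Real.cosh (y * v) :=
    integrable_shapeBump_mul (by fun_prop)
  have h2 : Integrable fun v : ℝ ↦ expNegInvGlue (1 - v ^ 2) := by
    simpa using integrable_shapeBump_mul (h := fun _ ↦ (1 : ℝ)) continuous_const
  have h3 : Integrable fun v : ℝ ↦ expNegInvGlue (1 - v ^ 2) * v ^ 2 :=
    integrable_shapeBump_mul (by fun_prop)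
  rw [← integral_const_mul, ← integral_add h2 (h3.const_mul _)]
  refine integral_mono h1 (h2.add (h3.const_mul _)) fun v ↦ ?_
  simp only
  by_cases hv : |v| ≤ 1
  · have h := cosh_mul_le y hv
    have h0 : 0 ≤ expNegInvGlue (1 - v ^ 2) := expNegInvGlue.nonneg _
    nlinarith
  · rw [shapeBump_eq_zero ((one_le_sq_iff_one_le_abs v).2 (le_of_lt (not_le.1 hv)))]
    simp

/-! ### Large `y`: the edge decay -/

/-- **`φ₀(v) ≤ e^{−1/(2(1 − |v|))}` for `|v| < 1`** (`1 − v² = (1 − |v|)(1 + |v|) ≤ 2(1 − |v|)`). [folklore] -/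
theorem shapeBump_le_exp_edge {v : ℝ} (hv : |v| < 1) :
    expNegInvGlue (1 - v ^ 2) ≤ Real.exp (-(1 / (2 * (1 - |v|)))) := by
  have hδ : 0 < 1 - |v| := by linarith
  have h1 : 0 < 1 - v ^ 2 := by
    rw [← sq_abs]; nlinarith [abs_nonneg v]
  have hle : 1 - v ^ 2 ≤ 2 * (1 - |v|) := by
    rw [← sq_abs]; nlinarith [abs_nonneg v]
  rw [show expNegInvGlue (1 - v ^ 2) = Real.exp (-(1 - v ^ 2)⁻¹) by
    simp [expNegInvGlue, not_le.2 h1]]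
  apply Real.exp_le_exp.2
  rw [neg_le_neg_iff, one_div]
  exact inv_anti₀ h1 hle

/-- AM–GM in the form used: `√(2y) ≤ 1/(2δ) + yδ` for `δ > 0`, `y ≥ 0`. [folklore] -/
theorem sqrt_two_mul_le {y δ : ℝ} (hy : 0 ≤ y) (hδ : 0 < δ) : Real.sqrt (2 * y) ≤ 1 / (2 * δ) + y * δ := by
  set s := Real.sqrt (2 * y) with hs
  have hs2 : s ^ 2 = 2 * y := Real.sq_sqrt (by linarith)
  have hs0 : 0 ≤ s := Real.sqrt_nonneg _
  rw [div_add' _ _ _ (by positivity), le_div_iff₀ (by positivity)]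
  have h := sq_nonneg (s * δ - 1)
  have e : (s * δ - 1) ^ 2 = 2 * y * δ ^ 2 - 2 * (s * δ) + 1 := by
    rw [sub_sq, mul_pow, hs2]; ring
  nlinarith [h, e]

/-- Pointwise: `φ₀(v) cosh(yv) ≤ e^{y − √(2y)}` for `y ≥ 0` and every `v`. [folklore] -/
theorem shapeBump_mul_cosh_le {y : ℝ} (hy : 0 ≤ y) (v : ℝ) :
    expNegInvGlue (1 - v ^ 2) * Real.cosh (y * v) ≤ Real.exp (y - Real.sqrt (2 * y)) := by
  by_cases hv : |v| < 1
  · have hδ : 0 < 1 - |v| := by linarith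
    have hcosh : Real.cosh (y * v) ≤ Real.exp (y * |v|) := by
      rw [Real.cosh_eq]
      have ha : Real.exp (y * v) ≤ Real.exp (y * |v|) :=
        Real.exp_le_exp.2 (mul_le_mul_of_nonneg_left (le_abs_self v) hy)
      have hb : Real.exp (-(y * v)) ≤ Real.exp (y * |v|) :=
        Real.exp_le_exp.2 (by nlinarith [neg_abs_le v])
      linarith
    have hφ := shapeBump_le_exp_edge hv
    have hφ0 : 0 ≤ expNegInvGlue (1 - v ^ 2) := expNegInvGlue.nonneg _
    calc expNegInvGlue (1 - v ^ 2) * Real.cosh (y * v)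
        ≤ Real.exp (-(1 / (2 * (1 - |v|)))) * Real.exp (y * |v|) :=
          mul_le_mul hφ hcosh (Real.cosh_pos _).le (Real.exp_pos _).le
      _ = Real.exp (y - (1 / (2 * (1 - |v|)) + y * (1 - |v|))) := by
          rw [← Real.exp_add]; congr 1; ring
      _ ≤ Real.exp (y - Real.sqrt (2 * y)) :=
          Real.exp_le_exp.2 (by linarith [sqrt_two_mul_le hy hδ])
  · rw [shapeBump_eq_zero ((one_le_sq_iff_one_le_abs v).2 (not_lt.1 hv)), zero_mul]
    exact (Real.exp_pos _).le

/-- **Stub `stub_coshMomentEdge` (B1 one-variable estimate, large `y`; registered on crux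
stmt-RiemannHypothesis-11229).** `∫ φ₀(v) cosh(yv) dv ≤ 2 e^{y − √(2y)}` for `y ≥ 0` (the integrand lives on
`[−1, 1]` and is pointwise `≤ e^{y − √(2y)}`). [folklore] -/
theorem stub_coshMomentEdge : ∀ y : ℝ, 0 ≤ y →
    ∫ v : ℝ, expNegInvGlue (1 - v ^ 2) * Real.cosh (y * v) ≤ 2 * Real.exp (y - Real.sqrt (2 * y)) := by
  intro y hy
  set C : ℝ := Real.exp (y - Real.sqrt (2 * y)) with hC
  have hC0 : 0 ≤ C := (Real.exp_pos _).le
  -- the integrand vanishes off `[−1, 1]` and is `≤ C` on it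
  have hsupp : ∀ v, v ∉ Icc (-1 : ℝ) 1 → expNegInvGlue (1 - v ^ 2) * Real.cosh (y * v) = 0 := by
    intro v hv
    have : expNegInvGlue (1 - v ^ 2) = 0 := by
      by_contra h
      exact hv (support_shapeBump_subset (Function.mem_support.2 h))
    rw [this, zero_mul]
  have hpt : ∀ v, expNegInvGlue (1 - v ^ 2) * Real.cosh (y * v) ≤ (Icc (-1 : ℝ) 1).indicator (fun _ ↦ C) v := by
    intro v
    by_cases hv : v ∈ Icc (-1 : ℝ) 1
    · rw [indicator_of_mem hv]
      exact shapeBump_mul_cosh_le hy v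
    · rw [indicator_of_notMem hv, hsupp v hv]
  have hint : Integrable fun v : ℝ ↦ expNegInvGlue (1 - v ^ 2) * Real.cosh (y * v) :=
    integrable_shapeBump_mul (by fun_prop)
  have hind : Integrable ((Icc (-1 : ℝ) 1).indicator fun _ : ℝ ↦ C) :=
    ((continuous_const (y := C)).integrableOn_Icc (a := (-1 : ℝ)) (b := 1)).integrable_indicator
      measurableSet_Icc
  calc ∫ v : ℝ, expNegInvGlue (1 - v ^ 2) * Real.cosh (y * v)
      ≤ ∫ v : ℝ, (Icc (-1 : ℝ) 1).indicator (fun _ ↦ C) v := integral_mono hint hind hpt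
    _ = 2 * C := by
        rw [integral_indicator measurableSet_Icc, setIntegral_const, Real.volume_real_Icc_of_le (by norm_num),
          smul_eq_mul]
        norm_num

end Summit.RiemannHypothesis.RiemannHypothesis.Theorems.WeilCombCoshMoments

end
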